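import Mathlib
import HarnessLib
import Summits.HubbardSuperconductivity.HubbardSuperconductivity.Theorems.KLProgrammeC4aPartnerBandTangencyDefectPh
import Summits.HubbardSuperconductivity.HubbardSuperconductivity.Theorems.KLProgrammePerturbedFermiCurveCompChainStruct

/-!
# Route `KLProgramme` — crux C4a, S3 brick (B2, TANGENCY, CURVATURE COEFFICIENT): at the tangency configuration the partner band of the loop point `Φ(0, φ+θ)` is
# `b_T(θ)·φ² + O(|φ|³)` with `b_T(θ) = D²e_K(Φ(0,θ))[∂_sΦ(0,θ), ∂_sΦ(0,θ)]` — the curvature term of the Fermi curve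

Cell `gate-hubbard-kl`, lane hubbard-kl-c4a-1 (g6); helper for stub (C) `stub_twoLeg_curvature` of the engine-flow child `KLRegimeEngineV17F2`
(stmt-HubbardSuperconductivity-20437); memo HOME/hubbard-kl-c4a-1/C4A-PLAN.md §24.4 (ii), §24.8 (i).  The order-0 value file `…C4aPartnerBandTangencyValue` gives `|ē| ≤ Cφ² + …`;
(B4)-(T) needs the COEFFICIENT: with `g(φ) := f(Γ(θ) + Γ(θ) − Γ(φ+θ))` (`f ∘ Γ ≡ 0`), `g(0) = 0`, `g′(0) = −Df(Γ)[Γ′] = 0`, `g″(0) = D²f(Γ)[Γ′,Γ′] − Df(Γ)[Γ″] = 2·D²f(Γ)[Γ′,Γ′]`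
(since `(f∘Γ)″ = D²f[Γ′,Γ′] + Df[Γ″] = 0`), and `|g‴| ≤ K₃D₁³ + 3K₂D₁D₂ + K₁D₃` (`…CompChainStruct.abs_iteratedDeriv_three_comp_le_struct`).  A LOWER bound `b_T ≥ b₀ > 0` (strict
convexity of the Fermi curve, uniform in the frame) is NOT proved here — it needs a certified curvature row (memo §24.8 (i)).

* `norm_sub_taylor_two_le_cube`, `abs_sub_sq_mul_le_cube` — third-order Taylor estimates from three mean-value steps;
* `abs_comp_sub_curv_sq_le` — the carrier-free statement: `|f(Γ(θ)+Γ(θ)−Γ(φ+θ)) − φ²·D²f(Γ(θ))[Γ′(θ),Γ′(θ)]| ≤ (K₃D₁³ + 3K₂D₁D₂ + K₁D₃)·|φ|³`;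
* **`abs_partnerBand_pp_tangency_sub_curv_le`**, **`abs_partnerBand_ph_tangency_sub_curv_le`** — the pp loop at `(ρ,ϑ) = (0,0)` and the ph loop at `(0,π)`, loop level `0`.

Pure calculus on landed objects; nothing about the model's sizes; nothing asserts superconductivity.  References: FST II CPAM 51 (1998) §3; BGM 2006 §2.4 (2.40) [cite: BenfattoGiulianiMastropietro2006].
-/

noncomputable section

namespace Summit.HubbardSuperconductivity.HubbardSuperconductivity.Theorems.C4a

set_option linter.dupNamespace false -- summit = problem name (single-conjunct summit), D-0017

open Real Set Filter
open scoped Topology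
open Literature.MathematicalPhysics.QuantumLattice Literature.MathematicalPhysics.QuantumLattice.BandSectorCounting Literature.Probability.LatticeModels
open Summit.HubbardSuperconductivity.HubbardSuperconductivity.Theorems.KLRegimeSplit
open Summit.HubbardSuperconductivity.HubbardSuperconductivity.Theorems.DispersionFlow
open Summit.HubbardSuperconductivity.HubbardSuperconductivity.Theorems.PerturbedFermiCurve

section Abstract

variable {V : Type*} [NormedAddCommGroup V] [NormedSpace ℝ V]

/-- **Third-order Taylor estimate from three mean-value steps** (vector-valued): `g′ = g₁`, `g₁′ = g₂`, `g₂′ = g₃`, `‖g₃‖ ≤ M` between `0` and `φ` ⇒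
`‖g(φ) − g(0) − φ·g₁(0) − (φ²/2)·g₂(0)‖ ≤ M·|φ|³`. [folklore] -/
theorem norm_sub_taylor_two_le_cube {g g₁ g₂ g₃ : ℝ → V} (h₀ : ∀ x, HasDerivAt g (g₁ x) x) (h₁ : ∀ x, HasDerivAt g₁ (g₂ x) x)
    (h₂ : ∀ x, HasDerivAt g₂ (g₃ x) x) {M φ : ℝ} (hM : ∀ x, |x| ≤ |φ| → ‖g₃ x‖ ≤ M) :
    ‖g φ - g 0 - φ • g₁ 0 - (φ ^ 2 / 2) • g₂ 0‖ ≤ M * |φ| ^ 3 := by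
  have hM0 : 0 ≤ M := (norm_nonneg _).trans (hM 0 (by rw [abs_zero]; exact abs_nonneg φ))
  have stepA : ∀ x, |x| ≤ |φ| → ‖g₁ x - g₁ 0 - x • g₂ 0‖ ≤ M * x ^ 2 := fun x hx =>
    norm_sub_sub_smul_le_sq h₁ h₂ (φ := x) (fun y hy => hM y (hy.trans hx))
  have hG' : ∀ x, HasDerivAt (fun y : ℝ => g y - g 0 - y • g₁ 0 - (y ^ 2 / 2) • g₂ 0) (g₁ x - g₁ 0 - x • g₂ 0) x := fun x => by
    have h1 : HasDerivAt (fun y : ℝ => y • g₁ 0) ((1 : ℝ) • g₁ 0) x := (hasDerivAt_id' x).smul_const _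
    have h2 : HasDerivAt (fun y : ℝ => (y ^ 2 / 2) • g₂ 0) ((((2 : ℕ) : ℝ) * x ^ (2 - 1) / 2) • g₂ 0) x :=
      ((hasDerivAt_pow 2 x).div_const 2).smul_const _
    exact ((((h₀ x).sub_const (g 0)).sub h1).sub h2).congr_deriv (by rw [one_smul, show ((2 : ℕ) : ℝ) * x ^ (2 - 1) / 2 = x by push_cast; ring])
  have h := (convex_uIcc (0 : ℝ) φ).norm_image_sub_le_of_norm_hasDerivWithin_le (f := fun y : ℝ => g y - g 0 - y • g₁ 0 - (y ^ 2 / 2) • g₂ 0)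
    (f' := fun x => g₁ x - g₁ 0 - x • g₂ 0) (fun y _ => (hG' y).hasDerivWithinAt)
    (fun y hy => (stepA y (abs_le_abs_of_mem_uIcc_zero hy)).trans
      (mul_le_mul_of_nonneg_left (sq_le_sq.2 (abs_le_abs_of_mem_uIcc_zero hy)) hM0))
    left_mem_uIcc right_mem_uIcc
  have e : (g φ - g 0 - φ • g₁ 0 - (φ ^ 2 / 2) • g₂ 0) - (g 0 - g 0 - (0 : ℝ) • g₁ 0 - ((0 : ℝ) ^ 2 / 2) • g₂ 0) =
      g φ - g 0 - φ • g₁ 0 - (φ ^ 2 / 2) • g₂ 0 := by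
    simp
  rw [e, sub_zero, Real.norm_eq_abs] at h
  calc ‖g φ - g 0 - φ • g₁ 0 - (φ ^ 2 / 2) • g₂ 0‖ ≤ M * φ ^ 2 * |φ| := h
    _ = M * |φ| ^ 3 := by rw [← sq_abs]; ring

/-- **Third-order Taylor estimate** (scalar): `ψ(0) = 0`, `ψ′(0) = 0`, `|ψ‴| ≤ M` between `0` and `φ` ⇒ `|ψ(φ) − (φ²/2)·ψ″(0)| ≤ M·|φ|³`. [folklore] -/
theorem abs_sub_sq_mul_le_cube {ψ ψ₁ ψ₂ ψ₃ : ℝ → ℝ} (h₀ : ∀ x, HasDerivAt ψ (ψ₁ x) x) (h₁ : ∀ x, HasDerivAt ψ₁ (ψ₂ x) x)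
    (h₂ : ∀ x, HasDerivAt ψ₂ (ψ₃ x) x) (hψ : ψ 0 = 0) (hψ₁ : ψ₁ 0 = 0) {M φ : ℝ} (hM : ∀ x, |x| ≤ |φ| → |ψ₃ x| ≤ M) :
    |ψ φ - φ ^ 2 / 2 * ψ₂ 0| ≤ M * |φ| ^ 3 := by
  have h := norm_sub_taylor_two_le_cube h₀ h₁ h₂ (φ := φ) (fun x hx => by rw [Real.norm_eq_abs]; exact hM x hx)
  rwa [hψ, hψ₁, smul_zero, sub_zero, sub_zero, smul_eq_mul, Real.norm_eq_abs] at h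

/-- **THE CURVATURE COEFFICIENT AT TANGENCY** (carrier-free): for `f ∈ C⁴` (`K₁,K₂,K₃`), a `C⁴` curve `Γ` in the zero level of `f` (`D₁,D₂,D₃`), and all `θ, φ`:
`|f(Γ(θ) + Γ(θ) − Γ(φ+θ)) − φ²·D²f(Γ(θ))[Γ′(θ),Γ′(θ)]| ≤ (K₃D₁³ + 3K₂D₁D₂ + K₁D₃)·|φ|³`. -/
theorem abs_comp_sub_curv_sq_le {f : V → ℝ} (hf : ContDiff ℝ 4 f) {K₁ K₂ K₃ : ℝ} (hK₁ : ∀ x, ‖fderiv ℝ f x‖ ≤ K₁) (hK₂ : ∀ x, ‖iteratedFDeriv ℝ 2 f x‖ ≤ K₂)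
    (hK₃ : ∀ x, ‖iteratedFDeriv ℝ 3 f x‖ ≤ K₃) {Γ : ℝ → V} (hΓ : ContDiff ℝ 4 Γ) (hΓ0 : ∀ s, f (Γ s) = 0) {D₁ D₂ D₃ : ℝ}
    (hD₁ : ∀ s, ‖iteratedDeriv 1 Γ s‖ ≤ D₁) (hD₂ : ∀ s, ‖iteratedDeriv 2 Γ s‖ ≤ D₂) (hD₃ : ∀ s, ‖iteratedDeriv 3 Γ s‖ ≤ D₃) (θ φ : ℝ) :
    |f (Γ θ + Γ θ - Γ (φ + θ)) - φ ^ 2 * fderiv ℝ (fderiv ℝ f) (Γ θ) (iteratedDeriv 1 Γ θ) (iteratedDeriv 1 Γ θ)| ≤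
      (K₃ * D₁ ^ 3 + 3 * K₂ * D₁ * D₂ + K₁ * D₃) * |φ| ^ 3 := by
  -- the argument curve `c(x) = 2Γ(θ) − Γ(x + θ)` and its jets
  have hshift : ContDiff ℝ 4 (fun x : ℝ => Γ (x + θ)) := hΓ.comp (contDiff_id.add contDiff_const)
  have hc : ContDiff ℝ 4 (fun x : ℝ => Γ θ + Γ θ - Γ (x + θ)) := contDiff_const.sub hshift
  have hg : ContDiff ℝ 4 (f ∘ fun x : ℝ => Γ θ + Γ θ - Γ (x + θ)) := hf.comp hc
  have hcj : ∀ {j : ℕ}, 0 < j → ∀ x : ℝ, iteratedDeriv j (fun x : ℝ => Γ θ + Γ θ - Γ (x + θ)) x = -iteratedDeriv j Γ (x + θ) := fun {j} hj x => by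
    rw [iteratedDeriv_const_sub hj, iteratedDeriv_neg, show (fun x : ℝ => Γ (x + θ)) = fun x : ℝ => Γ (x + θ) from rfl, iteratedDeriv_comp_add_const]
  -- `(f∘Γ)′ = (f∘Γ)″ = 0`
  have hconst : f ∘ Γ = fun _ => (0 : ℝ) := funext fun s => hΓ0 s
  have hc1 : fderiv ℝ f (Γ θ) (iteratedDeriv 1 Γ θ) = 0 := by
    rw [← iteratedDeriv_one_comp_eq hf hΓ θ, hconst, iteratedDeriv_const]; simp
  have hc2 : fderiv ℝ (fderiv ℝ f) (Γ θ) (iteratedDeriv 1 Γ θ) (iteratedDeriv 1 Γ θ) + fderiv ℝ f (Γ θ) (iteratedDeriv 2 Γ θ) = 0 := by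
    rw [← iteratedDeriv_two_comp_eq hf hΓ θ, hconst, iteratedDeriv_const]; simp
  -- the derivative tower of `g = f ∘ c`
  have h₀ : ∀ x, HasDerivAt (f ∘ fun x : ℝ => Γ θ + Γ θ - Γ (x + θ)) (iteratedDeriv 1 (f ∘ fun x : ℝ => Γ θ + Γ θ - Γ (x + θ)) x) x := fun x => by
    have h := hasDerivAt_iteratedDeriv_of_contDiff_four hg (show 0 < 4 by norm_num) x
    rwa [iteratedDeriv_zero] at h
  have h₁ := fun x => hasDerivAt_iteratedDeriv_of_contDiff_four hg (show 1 < 4 by norm_num) x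
  have h₂ := fun x => hasDerivAt_iteratedDeriv_of_contDiff_four hg (show 2 < 4 by norm_num) x
  -- values at `0`
  have hg0 : (f ∘ fun x : ℝ => Γ θ + Γ θ - Γ (x + θ)) 0 = 0 := by
    show f (Γ θ + Γ θ - Γ (0 + θ)) = 0
    rw [zero_add, add_sub_cancel_right]; exact hΓ0 θ
  have hg1 : iteratedDeriv 1 (f ∘ fun x : ℝ => Γ θ + Γ θ - Γ (x + θ)) 0 = 0 := by
    rw [iteratedDeriv_one_comp_eq hf hc 0, hcj one_pos]
    simp only [zero_add, add_sub_cancel_right, map_neg, hc1, neg_zero]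
  have hg2 : iteratedDeriv 2 (f ∘ fun x : ℝ => Γ θ + Γ θ - Γ (x + θ)) 0 = 2 * fderiv ℝ (fderiv ℝ f) (Γ θ) (iteratedDeriv 1 Γ θ) (iteratedDeriv 1 Γ θ) := by
    rw [iteratedDeriv_two_comp_eq hf hc 0, hcj one_pos, hcj two_pos]
    simp only [zero_add, add_sub_cancel_right, map_neg, show ∀ (P : V →L[ℝ] ℝ) (z : V), (-P) z = -(P z) from fun _ _ => rfl, neg_neg]
    linear_combination (-1 : ℝ) * hc2
  -- `|g‴| ≤ M`
  have hM : ∀ x : ℝ, |x| ≤ |φ| → |iteratedDeriv 3 (f ∘ fun x : ℝ => Γ θ + Γ θ - Γ (x + θ)) x| ≤ K₃ * D₁ ^ 3 + 3 * K₂ * D₁ * D₂ + K₁ * D₃ := fun x _ =>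
    abs_iteratedDeriv_three_comp_le_struct hf hc (by rw [← norm_fderiv_eq_norm_iteratedFDeriv_one]; exact hK₁ _) (hK₂ _) (hK₃ _)
      (by rw [hcj one_pos, norm_neg]; exact hD₁ _) (by rw [hcj two_pos, norm_neg]; exact hD₂ _) (by rw [hcj three_pos, norm_neg]; exact hD₃ _)
  have h := abs_sub_sq_mul_le_cube h₀ h₁ h₂ hg0 hg1 hM
  rw [hg2, show φ ^ 2 / 2 * (2 * fderiv ℝ (fderiv ℝ f) (Γ θ) (iteratedDeriv 1 Γ θ) (iteratedDeriv 1 Γ θ)) =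
    φ ^ 2 * fderiv ℝ (fderiv ℝ f) (Γ θ) (iteratedDeriv 1 Γ θ) (iteratedDeriv 1 Γ θ) by ring] at h
  have hval : (f ∘ fun x : ℝ => Γ θ + Γ θ - Γ (x + θ)) φ = f (Γ θ + Γ θ - Γ (φ + θ)) := rfl
  rwa [hval] at h

end Abstract

section Sizes

variable {K : TrigPolyC4v} {A : ℝ} (hA : ∀ p : Momentum, ∀ j ≤ 2, ‖iteratedFDeriv ℝ j (frameShift K) p‖ ≤ A) (hA20 : A ≤ 1 / 20)
  (hd : klCurveD ≤ (bandBounds (show (-4 : ℝ) < -1.1 by norm_num) (show (-1.1 : ℝ) ≤ -0.1 by norm_num)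
    (show (-0.1 : ℝ) < 0 by norm_num)).Dtmin - 2 * A)
  {μ r : ℝ} (hr : 0 < r) (hlo : (-1.1 : ℝ) < μ - r - A) (hhi : μ + r + A < -0.1)
  {A₃ A₄ : ℝ} (hA₃ : ∀ p : Momentum, ‖iteratedFDeriv ℝ 3 (frameShift K) p‖ ≤ A₃)
  (hA₄ : ∀ p : Momentum, ‖iteratedFDeriv ℝ 4 (frameShift K) p‖ ≤ A₄)
  {K₁ K₂ K₃ : ℝ} (hK₁ : ∀ p : Momentum, ‖fderiv ℝ (frameLevel μ K) p‖ ≤ K₁) (hK₂ : ∀ p : Momentum, ‖iteratedFDeriv ℝ 2 (frameLevel μ K) p‖ ≤ K₂)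
  (hK₃ : ∀ p : Momentum, ‖iteratedFDeriv ℝ 3 (frameLevel μ K) p‖ ≤ K₃)
include hA hA20 hd hr hlo hhi hA₃ hA₄ hK₁ hK₂ hK₃

/-- **CURVATURE EXPANSION OF THE pp PARTNER BAND AT TANGENCY**: at `(ρ,ϑ) = (0,0)` and loop level `0`,
`|e_K(S_{0,0,θ}(0) − Φ(0, φ+θ)) − φ²·b_T(θ)| ≤ (K₃D₁³ + 3K₂D₁D₂ + K₁D₃)·|φ|³` with `b_T(θ) = D²e_K(Φ(0,θ))[∂_sΦ(0,θ), ∂_sΦ(0,θ)]`. -/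
theorem abs_partnerBand_pp_tangency_sub_curv_le (θ φ : ℝ) :
    |frameLevel μ K (pairSumPath μ K 0 0 θ 0 - levelPoint μ K 0 (φ + θ)) -
        φ ^ 2 * fderiv ℝ (fderiv ℝ (frameLevel μ K)) (levelPoint μ K 0 θ) (iteratedDeriv 1 (levelPoint μ K 0) θ) (iteratedDeriv 1 (levelPoint μ K 0) θ)| ≤
      (K₃ * msD A₃ A₄ 1 ^ 3 + 3 * K₂ * msD A₃ A₄ 1 * msD A₃ A₄ 2 + K₁ * msD A₃ A₄ 3) * |φ| ^ 3 := by
  set B₀ := bandBounds (show (-4 : ℝ) < -1.1 by norm_num) (show (-1.1 : ℝ) ≤ -0.1 by norm_num) (show (-0.1 : ℝ) < 0 by norm_num) with hB₀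
  have hADt : 2 * A < B₀.Dtmin := by have := klCurveD_pos; linarith
  have h0 : |(0 : ℝ)| < r := by simpa using hr
  rw [show pairSumPath μ K 0 0 θ 0 = levelPoint μ K 0 θ + levelPoint μ K 0 θ by simp only [pairSumPath, zero_add, add_zero]]
  exact abs_comp_sub_curv_sq_le (EngineV8.contDiff_frameLevel μ K) hK₁ hK₂ hK₃ (contDiff_levelPoint_angle B₀ hA hADt hlo hhi h0)
    (fun s => frameLevel_levelPoint_zero B₀ hA hr hlo hhi s) (fun s => norm_iteratedDeriv_levelPoint_le hA hA20 hd hlo hhi hA₃ hA₄ h0 le_rfl (by norm_num) s)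
    (fun s => norm_iteratedDeriv_levelPoint_le hA hA20 hd hlo hhi hA₃ hA₄ h0 (i := 2) (by norm_num) (by norm_num) s)
    (fun s => norm_iteratedDeriv_levelPoint_le hA hA20 hd hlo hhi hA₃ hA₄ h0 (i := 3) (by norm_num) (by norm_num) s) θ φ

/-- **CURVATURE EXPANSION OF THE ph PARTNER BAND AT `2k_F`**: at `(ρ,ϑ) = (0,π)` and loop level `0` (`e_K` even),
`|e_K(Φ(0, φ+θ) − D_{0,π,θ}(0)) − φ²·b_T(θ)| ≤ (K₃D₁³ + 3K₂D₁D₂ + K₁D₃)·|φ|³`. -/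
theorem abs_partnerBand_ph_tangency_sub_curv_le (θ φ : ℝ) :
    |frameLevel μ K (levelPoint μ K 0 (φ + θ) - pairDiffPath μ K 0 π θ 0) -
        φ ^ 2 * fderiv ℝ (fderiv ℝ (frameLevel μ K)) (levelPoint μ K 0 θ) (iteratedDeriv 1 (levelPoint μ K 0) θ) (iteratedDeriv 1 (levelPoint μ K 0) θ)| ≤
      (K₃ * msD A₃ A₄ 1 ^ 3 + 3 * K₂ * msD A₃ A₄ 1 * msD A₃ A₄ 2 + K₁ * msD A₃ A₄ 3) * |φ| ^ 3 := by
  set B₀ := bandBounds (show (-4 : ℝ) < -1.1 by norm_num) (show (-1.1 : ℝ) ≤ -0.1 by norm_num) (show (-0.1 : ℝ) < 0 by norm_num) with hB₀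
  have hADt : 2 * A < B₀.Dtmin := by have := klCurveD_pos; linarith
  have h0 : |(0 : ℝ)| < r := by simpa using hr
  rw [pairDiffPath_tangency, add_zero, show levelPoint μ K 0 (φ + θ) - (levelPoint μ K 0 θ + levelPoint μ K 0 θ) =
    -(levelPoint μ K 0 θ + levelPoint μ K 0 θ - levelPoint μ K 0 (φ + θ)) by abel, frameLevel_neg]
  exact abs_comp_sub_curv_sq_le (EngineV8.contDiff_frameLevel μ K) hK₁ hK₂ hK₃ (contDiff_levelPoint_angle B₀ hA hADt hlo hhi h0)
    (fun s => frameLevel_levelPoint_zero B₀ hA hr hlo hhi s) (fun s => norm_iteratedDeriv_levelPoint_le hA hA20 hd hlo hhi hA₃ hA₄ h0 le_rfl (by norm_num) s)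
    (fun s => norm_iteratedDeriv_levelPoint_le hA hA20 hd hlo hhi hA₃ hA₄ h0 (i := 2) (by norm_num) (by norm_num) s)
    (fun s => norm_iteratedDeriv_levelPoint_le hA hA20 hd hlo hhi hA₃ hA₄ h0 (i := 3) (by norm_num) (by norm_num) s) θ φ

end Sizes

end Summit.HubbardSuperconductivity.HubbardSuperconductivity.Theorems.C4a

end
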